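import Mathlib.Analysis.InnerProductSpace.PiL2
import Mathlib.Algebra.BigOperators.Ring.Finset
import Mathlib.Algebra.Order.BigOperators.Ring.Finset
import Literature.MathematicalPhysics.QuantumLattice.LatticeScalarField
import Literature.Probability.LatticeModels.ThermodynamicLimit
import HarnessLib

/-!
# Mesh-uniform bounds for lattice Riemann sums of Japanese brackets

When a lattice field on `aℤᵈ` is paired with a Schwartz test function, the elementary input of
every continuum-limit estimate (E0′ / temperedness uniform in the lattice spacing, e.g.
Osterwalder–Schrader II §2 for lattice approximants; Glimm–Jaffe 1987 §9.5–9.6) is that the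
Riemann sums of an integrable weight are bounded UNIFORMLY IN THE MESH `a ∈ (0, 1]`:

  `Σ_{x ∈ (ℤᵈ)ⁿ} a^{dn} (1 + ‖a x‖_∞)^{-2dn} ≤ C(d, n)`   (no constraint on the finite box).

This file proves it with the explicit constant `(2(a+1))^{dn}` by the product trick
`(1 + ‖a x‖_∞)^{-2dn} ≤ ∏_{i,μ} (1 + a|x_{iμ}|)^{-2}` and the one-dimensional telescoping bound
`Σ_{i ≥ 1} a (1 + a i)^{-2} ≤ Σ_{i ≥ 1} (1/(1 + a(i−1)) − 1/(1 + a i)) ≤ 1`: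

* `sum_range_mul_inv_one_add_mul_sq_le_one`, `sum_range_succ_weight_le` — the `ℕ` sums;
* `sum_weight_int_le` — any finite set of integers: `Σ_{j ∈ T} a/(1 + a|j|)² ≤ 2(a + 1)`;
* `sum_piFinset_prod_weight_le` — `ι → ℤ` configurations over a product set;
* `sum_piFinset_box_prod_weight_le` — `n` sites in the box `{−S..S}ᵈ` (tree `box d S`);
* `pow_div_one_add_pow_le_prod_weight`, `mul_abs_le_norm_smul_siteToE` and the consumable form
  `sum_piFinset_box_japaneseBracket_le`: for `0 ≤ a`,
  `Σ_{x ∈ (box d S)ⁿ} a^{dn} / (1 + ‖(a • siteToE (x i))_i‖)^{2dn} ≤ (2(a+1))^{dn}`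
  with the sup norm over `i` of the Euclidean norms in `ℝᵈ` (the norm of `Fin n → EuclideanSpace ℝ (Fin d)`
  on which `n`-point Schwartz test functions live). [folklore]
-/

open Finset
open Literature.Probability.LatticeModels

noncomputable section

namespace Literature.MathematicalPhysics.QuantumLattice

/-! ### One dimension -/

/-- Telescoping bound `Σ_{i<J} a/(1 + a(i+1))² ≤ 1 − 1/(1 + aJ)` for `0 ≤ a`
(each term is at most `1/(1 + a i) − 1/(1 + a(i+1))`). [folklore] -/
theorem sum_range_mul_inv_one_add_mul_sq_le (a : ℝ) (ha : 0 ≤ a) (J : ℕ) :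
    ∑ i ∈ range J, a / (1 + a * ((i : ℝ) + 1)) ^ 2 ≤ 1 - 1 / (1 + a * J) := by
  induction J with
  | zero => simp
  | succ J ih =>
    rw [sum_range_succ, Nat.cast_succ]
    have h0 : 0 < 1 + a * (J : ℝ) := by positivity
    have h1 : 0 < 1 + a * ((J : ℝ) + 1) := by positivity
    have key : a / (1 + a * ((J : ℝ) + 1)) ^ 2 ≤ 1 / (1 + a * J) - 1 / (1 + a * ((J : ℝ) + 1)) := by
      rw [div_sub_div _ _ h0.ne' h1.ne', div_le_div_iff₀ (by positivity) (by positivity)]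
      have : 1 * (1 + a * ((J : ℝ) + 1)) - (1 + a * J) * 1 = a := by ring
      rw [this]
      have hle : (1 + a * (J : ℝ)) ≤ 1 + a * ((J : ℝ) + 1) := by nlinarith
      calc a * ((1 + a * ↑J) * (1 + a * (↑J + 1)))
          ≤ a * ((1 + a * (↑J + 1)) * (1 + a * (↑J + 1))) := by gcongr
        _ = a * (1 + a * (↑J + 1)) ^ 2 := by ring
    linarith

/-- `Σ_{i<J} a/(1 + a(i+1))² ≤ 1` for `0 ≤ a`, uniformly in `J`. [folklore] -/
theorem sum_range_mul_inv_one_add_mul_sq_le_one (a : ℝ) (ha : 0 ≤ a) (J : ℕ) :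
    ∑ i ∈ range J, a / (1 + a * ((i : ℝ) + 1)) ^ 2 ≤ 1 := by
  have h := sum_range_mul_inv_one_add_mul_sq_le a ha J
  have : 0 ≤ 1 / (1 + a * (J : ℝ)) := by positivity
  linarith

/-- Including the origin: `Σ_{i ≤ J} a/(1 + a i)² ≤ a + 1` for `0 ≤ a`. [folklore] -/
theorem sum_range_succ_weight_le (a : ℝ) (ha : 0 ≤ a) (J : ℕ) :
    ∑ i ∈ range (J + 1), a / (1 + a * (i : ℝ)) ^ 2 ≤ a + 1 := by
  rw [sum_range_succ']
  simp only [Nat.cast_add, Nat.cast_one, Nat.cast_zero, mul_zero, add_zero, one_pow, div_one]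
  linarith [sum_range_mul_inv_one_add_mul_sq_le_one a ha J]

/-- **Any finite set of integers**: `Σ_{j ∈ T} a/(1 + a|j|)² ≤ 2(a + 1)` for `0 ≤ a` (the map
`j ↦ |j|` is at most two-to-one onto an initial segment of `ℕ`). [folklore] -/
theorem sum_weight_int_le (a : ℝ) (ha : 0 ≤ a) (T : Finset ℤ) :
    ∑ j ∈ T, a / (1 + a * |(j : ℝ)|) ^ 2 ≤ 2 * (a + 1) := by
  set f : ℕ → ℝ := fun i => a / (1 + a * (i : ℝ)) ^ 2 with hf
  have hf0 : ∀ i, 0 ≤ f i := fun i => by positivity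
  have hterm : ∀ j : ℤ, a / (1 + a * |(j : ℝ)|) ^ 2 = f j.natAbs := by
    intro j
    simp only [hf, Nat.cast_natAbs, Int.cast_abs]
  simp_rw [hterm]
  rw [sum_comp]
  set K := T.sup Int.natAbs with hK
  have hcard : ∀ i ∈ T.image Int.natAbs, (#{j ∈ T | j.natAbs = i} : ℝ) • f i ≤ (2 : ℝ) * f i := by
    intro i _
    rw [smul_eq_mul]
    refine mul_le_mul_of_nonneg_right ?_ (hf0 i)
    have hsub : {j ∈ T | j.natAbs = i} ⊆ ({(i : ℤ), -(i : ℤ)} : Finset ℤ) := by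
      intro j hj
      rw [mem_filter] at hj
      rcases Int.natAbs_eq_iff.mp hj.2 with h | h <;> simp [h]
    have := (card_le_card hsub).trans card_le_two
    exact_mod_cast this
  have himg : T.image Int.natAbs ⊆ range (K + 1) := by
    intro i hi
    obtain ⟨j, hj, rfl⟩ := mem_image.mp hi
    exact mem_range.mpr (Nat.lt_succ_of_le (le_sup (f := Int.natAbs) hj))
  calc ∑ i ∈ T.image Int.natAbs, #{j ∈ T | j.natAbs = i} • f i
      = ∑ i ∈ T.image Int.natAbs, (#{j ∈ T | j.natAbs = i} : ℝ) • f i := by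
        simp [nsmul_eq_mul]
    _ ≤ ∑ i ∈ T.image Int.natAbs, 2 * f i := sum_le_sum hcard
    _ ≤ ∑ i ∈ range (K + 1), 2 * f i :=
        sum_le_sum_of_subset_of_nonneg himg fun i _ _ => by positivity
    _ = 2 * ∑ i ∈ range (K + 1), f i := by rw [mul_sum]
    _ ≤ 2 * (a + 1) := by
        gcongr
        exact sum_range_succ_weight_le a ha K

/-! ### Lattices -/

/-- **Product sets of `ι → ℤ`**: `Σ_{x ∈ Tᶥ} ∏ᵢ a/(1 + a|xᵢ|)² ≤ (2(a+1))^{|ι|}`. [folklore] -/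
theorem sum_piFinset_prod_weight_le {ι : Type*} [Fintype ι] [DecidableEq ι] (a : ℝ) (ha : 0 ≤ a)
    (T : Finset ℤ) :
    ∑ x ∈ Fintype.piFinset (fun _ : ι => T), ∏ i, a / (1 + a * |(x i : ℝ)|) ^ 2 ≤
      (2 * (a + 1)) ^ Fintype.card ι := by
  rw [sum_prod_piFinset T (fun (_ : ι) (j : ℤ) => a / (1 + a * |(j : ℝ)|) ^ 2), prod_const,
    card_univ]
  exact pow_le_pow_left₀ (sum_nonneg fun j _ => by positivity) (sum_weight_int_le a ha T) _

/-- **`n` sites in the box `{−S..S}ᵈ`**: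
`Σ_{x ∈ (box d S)ⁿ} ∏ᵢ ∏_μ a/(1 + a|x_{iμ}|)² ≤ (2(a+1))^{dn}`, uniformly in `S`. [folklore] -/
theorem sum_piFinset_box_prod_weight_le (a : ℝ) (ha : 0 ≤ a) (d n S : ℕ) :
    ∑ x ∈ Fintype.piFinset (fun _ : Fin n => box d S),
        ∏ i, ∏ μ, a / (1 + a * |(x i μ : ℝ)|) ^ 2 ≤ (2 * (a + 1)) ^ (d * n) := by
  rw [sum_prod_piFinset (box d S) (fun (_ : Fin n) (z : Site d) => ∏ μ, a / (1 + a * |(z μ : ℝ)|) ^ 2),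
    prod_const, card_univ, Fintype.card_fin, pow_mul]
  refine pow_le_pow_left₀ (sum_nonneg fun z _ => prod_nonneg fun μ _ => by positivity) ?_ n
  have h := sum_piFinset_prod_weight_le (ι := Fin d) a ha (Finset.Icc (-(S : ℤ)) S)
  rw [Fintype.card_fin] at h
  simpa [box] using h

/-- **Domination of the sup-weight by the product weight**: if `a|x_{iμ}| ≤ R` for all `i, μ`
then `a^{dn}/(1 + R)^{2dn} ≤ ∏ᵢ ∏_μ a/(1 + a|x_{iμ}|)²`. [folklore] -/
theorem pow_div_one_add_pow_le_prod_weight (a : ℝ) (ha : 0 ≤ a) {d n : ℕ} (x : Fin n → Site d)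
    {R : ℝ} (hR : ∀ i μ, a * |(x i μ : ℝ)| ≤ R) :
    a ^ (d * n) / (1 + R) ^ (2 * (d * n)) ≤ ∏ i, ∏ μ, a / (1 + a * |(x i μ : ℝ)|) ^ 2 := by
  have hfac : ∀ i μ, a / (1 + R) ^ 2 ≤ a / (1 + a * |(x i μ : ℝ)|) ^ 2 := by
    intro i μ
    have h0 : 0 ≤ a * |(x i μ : ℝ)| := by positivity
    refine div_le_div_of_nonneg_left ha (by positivity) ?_
    exact pow_le_pow_left₀ (by positivity) (by linarith [hR i μ]) 2
  calc a ^ (d * n) / (1 + R) ^ (2 * (d * n))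
      = ∏ _i : Fin n, ∏ _μ : Fin d, a / (1 + R) ^ 2 := by
        rw [prod_const, prod_const, card_univ, card_univ, Fintype.card_fin, Fintype.card_fin,
          ← pow_mul, div_pow, ← pow_mul]
    _ ≤ ∏ i, ∏ μ, a / (1 + a * |(x i μ : ℝ)|) ^ 2 :=
        prod_le_prod (fun i _ => prod_nonneg fun μ _ => by positivity) fun i _ =>
          prod_le_prod (fun μ _ => by positivity) fun μ _ => hfac i μ

/-- Coordinates are dominated by the configuration norm: for `0 ≤ a`,
`a|x_{iμ}| ≤ ‖(a • siteToE (x i))_i‖` (sup over `i` of Euclidean norms). [folklore] -/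
theorem mul_abs_le_norm_smul_siteToE {a : ℝ} (ha : 0 ≤ a) {d n : ℕ} (x : Fin n → Site d)
    (i : Fin n) (μ : Fin d) :
    a * |(x i μ : ℝ)| ≤ ‖fun i => a • siteToE (x i)‖ := by
  calc a * |(x i μ : ℝ)| = ‖(a • siteToE (x i)) μ‖ := by
        simp [Real.norm_eq_abs, abs_of_nonneg ha]
    _ ≤ ‖a • siteToE (x i)‖ := PiLp.norm_apply_le _ μ
    _ ≤ ‖fun i => a • siteToE (x i)‖ := norm_le_pi_norm (fun i => a • siteToE (x i)) i

/-- **Mesh-uniform Riemann bound (consumable form).** For `0 ≤ a` and all `d, n, S`: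
`Σ_{x ∈ (box d S)ⁿ} a^{dn} / (1 + ‖(a • siteToE (x i))_i‖)^{2dn} ≤ (2(a+1))^{dn}` — the lattice
Riemann sums of the Japanese bracket of order `2dn` on `(ℝᵈ)ⁿ` are bounded uniformly in the
mesh `a ≤ 1` and in the box. [folklore] -/
theorem sum_piFinset_box_japaneseBracket_le (a : ℝ) (ha : 0 ≤ a) (d n S : ℕ) :
    ∑ x ∈ Fintype.piFinset (fun _ : Fin n => box d S),
        a ^ (d * n) / (1 + ‖fun i => a • siteToE (x i)‖) ^ (2 * (d * n)) ≤
      (2 * (a + 1)) ^ (d * n) :=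
  (sum_le_sum fun x _ => pow_div_one_add_pow_le_prod_weight a ha x
    (fun i μ => mul_abs_le_norm_smul_siteToE ha x i μ)).trans
    (sum_piFinset_box_prod_weight_le a ha d n S)

end Literature.MathematicalPhysics.QuantumLattice

end
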